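import Summits.NavierStokesRegularity.FluidComputer.PalasekTowerRegisterGlobalHeredity
import Literature.Analysis.FluidPDE.LoopCirculation

/-!
# REGISTER v2.3′: the lower half read through its Kelvin-critical conjunct — what a registered core loop costs the flow

Cell `ns-blowup`, seat `ns-blowup-ecbridge-5` (g3); companion of `PalasekTowerRegisterGlobalHeredity.lean`
(p415576: the halves `ContinuationEnvelope` / `ReadoutFloors` of the child crux `HeredityFrom 2`, item
stmt-NavierStokesRegularity-19250) and `PalasekTowerRegisterGlobalHalves.lean` (p419350). LABEL: E–C typing
(KERNEL: elementary loop kinematics + register corollaries, every statement proved). WHAT THIS IS NOT: not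
Navier–Stokes evidence — no stage, flow or tower is constructed or asserted; nothing below bears on whether
the open halves hold.

`ReadoutFloors` asks three floors of level `k + 1` at its readout: the velocity floor `c₁ Y_{k+1}`, the
strain floor `c₁ A_{k+1}`, and the CORE LEDGER clause (a closed `C¹` loop of speed `≤ 8π / N_{k+1}` inside a
ball of radius `1 / N_{k+1}` centred in the tower's ball, circulation `≥ c₁ N_{k+1}^{β-2}`). With no
hypothesis beyond the register's typing, the core clause ALONE carries the other two floors up to the
constant `8π` and a ball slack `1 / N_{k+1}`, and a stage's own ceiling caps the circulation of every
registered loop — the three floors are one Kelvin-critical bet up to constants (the barrier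
`Literature.Barriers.NavierStokesRegularity.PalasekTowerKelvinCeiling` attaches to the core clause), and
the registered core circulation lives in a definite band:

* §1 loop kinematics (real inner product space; the register's loop class = pointwise speed bound on
  `[0, 1]`, image in a closed ball): `abs_circulation_le_of_speed_le` (`|∮_γ v·dℓ| ≤ U·L`),
  `exists_norm_ge_circulation_div` (a point ON the loop with `‖v‖ ≥ Γ / L`),
  `abs_circulation_le_of_fderiv_le` (`|∮_γ v·dℓ| ≤ G·r·L` when `‖Dv‖ ≤ G` on the ball `B̄(x, r)` holding the
  closed loop: constant fields have zero circulation around closed `C¹` loops,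
  `Literature.Analysis.FluidPDE.circulation_const_left`, plus the mean-value inequality — NO Stokes theorem),
  `exists_norm_fderiv_ge_circulation_div` (a point IN the ball with `‖Dv‖ ≥ Γ / (r L)`);
* §2 `Y_j = N_j^{β-2} N_j`, `A_j = N_j^{β-2} N_j²`; one registered loop of level `j` forces speed
  `≥ c₁ Y_j / (8π)` on the loop and strain `≥ c₁ A_j / (8π)` in the core ball, both within `radius + 1/N_j`
  of the origin (`core_loop_speed_floor`, `core_loop_strain_floor`); a ceiling `c₂ Y_j` caps every
  level-`j` loop at `8π c₂ N_j^{β-2}` (`abs_circulation_le_of_ceiling`);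
* §3 register: `CoreLedger.exists_speed_ge` / `.exists_fderiv_ge`; `Stage.abs_circulation_loop_le`;
  for the v2.3′ margin `Stage.routeG_core_speed_ge`, `Stage.routeG_core_strain_ge`,
  `Stage.routeG_core_circulation_band` (`c₁ N_j^{β-2} ≤ Γ ≤ 8π c₂ N_j^{β-2}`, any `ν` / rates) and
  `Stage.routeG_core_circulation_band_rigid` (rigid, wide: `N_j^{3/10} ≤ Γ ≤ (40π/3) N_j^{3/10}` — the
  circulation Reynolds number of the registered core at unit viscosity, inside the fixed factor `40π/3`);
* §4 readout of a continuation (the objects of `ReadoutFloors`): `readout_core_floors`,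
  `readout_core_circulation_le`, and `ReadoutFloors.weak_floors_of_core` — kernel form of «the lower half
  is its core conjunct up to `8π` and the slack `1/N_{k+1} ≤ 256^{-121/100}`».

The rigid-window numbers (stretch budget, window in diffusion units at the child scale) are in the sibling
`PalasekTowerRegisterGlobalCoreWindow.lean`. References: S. Palasek, arXiv:2605.13827 §3.1, §3.3
[cite: Palasek2026ElementaryModel, §3]; A. J. Majda, A. L. Bertozzi, *Vorticity and Incompressible Flow*,
CUP 2002, §1.6 eq. (1.57) [cite: MajdaBertozziCUP2002, §1.6].
-/

noncomputable section

namespace Summit.NavierStokesRegularity.FluidComputer.PalasekTowerClayBridge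

open Set MeasureTheory Filter Topology Function Real
open scoped ENNReal ContDiff NNReal InnerProductSpace RealInnerProductSpace
open Literature.Analysis.FluidPDE

/-! ## §1 Loop kinematics: circulation against speed and strain bounds -/

section LoopKinematics

variable {E : Type*} [NormedAddCommGroup E] [InnerProductSpace ℝ E]

/-- **Circulation against a speed bound along the loop.** If `‖v (γ s)‖ ≤ U` and `‖γ' s‖ ≤ L` for
`s ∈ [0, 1]`, then `|∮_γ v · dℓ| ≤ U · L` for the tree's `circulation v γ = ∫₀¹ ⟪v (γ s), γ' s⟫ ds`
(Cauchy–Schwarz under the integral sign; the register's loop class carries exactly the pointwise speed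
bound). [cite: MajdaBertozziCUP2002, §1.6 eq. (1.57)] -/
theorem abs_circulation_le_of_speed_le {v : E → E} {γ : ℝ → E} {U L : ℝ}
    (hU : ∀ s ∈ Icc (0 : ℝ) 1, ‖v (γ s)‖ ≤ U) (hL : ∀ s ∈ Icc (0 : ℝ) 1, ‖deriv γ s‖ ≤ L) :
    |circulation v γ| ≤ U * L := by
  have hU0 : 0 ≤ U := (norm_nonneg _).trans (hU 0 ⟨le_rfl, zero_le_one⟩)
  have h : ∀ s ∈ Set.uIoc (0 : ℝ) 1, ‖⟪v (γ s), deriv γ s⟫_ℝ‖ ≤ U * L := by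
    intro s hs
    have hs' : s ∈ Icc (0 : ℝ) 1 := by
      rw [uIoc_of_le zero_le_one] at hs
      exact Ioc_subset_Icc_self hs
    calc ‖⟪v (γ s), deriv γ s⟫_ℝ‖ ≤ ‖v (γ s)‖ * ‖deriv γ s‖ := norm_inner_le_norm _ _
      _ ≤ U * L := mul_le_mul (hU s hs') (hL s hs') (norm_nonneg _) hU0
  have h2 := intervalIntegral.norm_integral_le_of_norm_le_const h
  rw [sub_zero, abs_one, mul_one, Real.norm_eq_abs] at h2
  exact h2

/-- **A loop of speed `≤ L` carrying circulation `Γ` meets speed `≥ Γ / L` somewhere** (field continuous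
along the loop; maximum of `‖v ∘ γ‖` on the compact `[0, 1]` and `abs_circulation_le_of_speed_le`). [folklore] -/
theorem exists_norm_ge_circulation_div {v : E → E} {γ : ℝ → E} {L : ℝ} (hL0 : 0 < L)
    (hv : Continuous fun s => v (γ s)) (hL : ∀ s ∈ Icc (0 : ℝ) 1, ‖deriv γ s‖ ≤ L) :
    ∃ s ∈ Icc (0 : ℝ) 1, circulation v γ / L ≤ ‖v (γ s)‖ := by
  obtain ⟨s₀, hs₀, hmax⟩ := isCompact_Icc.exists_isMaxOn (nonempty_Icc.2 (zero_le_one (α := ℝ)))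
    ((continuous_norm.comp hv).continuousOn)
  refine ⟨s₀, hs₀, ?_⟩
  rw [div_le_iff₀ hL0]
  exact (le_abs_self _).trans
    (abs_circulation_le_of_speed_le (fun s hs => isMaxOn_iff.1 hmax s hs) hL)

/-- **Circulation against a strain bound on a ball containing the loop.** If `v` is continuous,
differentiable on `B̄(x, r)` with `‖Dv‖ ≤ G` there, and `γ` is a closed `C¹` loop in `B̄(x, r)` of speed
`≤ L`, then `|∮_γ v · dℓ| ≤ G · r · L`: the constant field `v x` has zero circulation around the closed loop
(`circulation_const_left`) and `‖v (γ s) - v x‖ ≤ G r` by the mean-value inequality on the convex ball —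
no Stokes theorem. [cite: MajdaBertozziCUP2002, §1.6 eq. (1.57)] -/
theorem abs_circulation_le_of_fderiv_le {v : E → E} {γ : ℝ → E} {x : E} {r G L : ℝ}
    (hvc : Continuous v) (hv : ∀ y ∈ Metric.closedBall x r, DifferentiableAt ℝ v y)
    (hG : ∀ y ∈ Metric.closedBall x r, ‖fderiv ℝ v y‖ ≤ G)
    (hγ : ContDiff ℝ 1 γ) (hloop : γ 0 = γ 1)
    (hball : ∀ s ∈ Icc (0 : ℝ) 1, γ s ∈ Metric.closedBall x r)
    (hL : ∀ s ∈ Icc (0 : ℝ) 1, ‖deriv γ s‖ ≤ L) :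
    |circulation v γ| ≤ G * r * L := by
  have hr : 0 ≤ r := dist_nonneg.trans (Metric.mem_closedBall.1 (hball 0 ⟨le_rfl, zero_le_one⟩))
  have hx : x ∈ Metric.closedBall x r := Metric.mem_closedBall_self hr
  have hG0 : 0 ≤ G := (norm_nonneg _).trans (hG x hx)
  have hsub : circulation v γ = circulation (v - fun _ => v x) γ := by
    rw [circulation_sub_left hvc continuous_const hγ, circulation_const_left hγ hloop, sub_zero]
  rw [hsub]
  refine abs_circulation_le_of_speed_le (fun s hs => ?_) hL
  have hmv : ‖v (γ s) - v x‖ ≤ G * ‖γ s - x‖ :=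
    (convex_closedBall x r).norm_image_sub_le_of_norm_fderiv_le hv hG hx (hball s hs)
  have hdist : ‖γ s - x‖ ≤ r := by rw [← dist_eq_norm]; exact Metric.mem_closedBall.1 (hball s hs)
  show ‖v (γ s) - v x‖ ≤ G * r
  exact hmv.trans (mul_le_mul_of_nonneg_left hdist hG0)

/-- **A closed loop of speed `≤ L` in a ball of radius `r` carrying circulation `Γ` meets strain
`≥ Γ / (r L)` in the ball** (`C¹` field on a proper space; maximum of `‖Dv‖` on the compact ball). [folklore] -/
theorem exists_norm_fderiv_ge_circulation_div [ProperSpace E] {v : E → E} {γ : ℝ → E} {x : E}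
    {r L : ℝ} (hr : 0 < r) (hL0 : 0 < L) (hv : ContDiff ℝ 1 v)
    (hγ : ContDiff ℝ 1 γ) (hloop : γ 0 = γ 1)
    (hball : ∀ s ∈ Icc (0 : ℝ) 1, γ s ∈ Metric.closedBall x r)
    (hL : ∀ s ∈ Icc (0 : ℝ) 1, ‖deriv γ s‖ ≤ L) :
    ∃ y ∈ Metric.closedBall x r, circulation v γ / (r * L) ≤ ‖fderiv ℝ v y‖ := by
  have hcont : Continuous fun y => ‖fderiv ℝ v y‖ :=
    continuous_norm.comp (hv.continuous_fderiv one_ne_zero)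
  obtain ⟨y₀, hy₀, hmax⟩ := (isCompact_closedBall x r).exists_isMaxOn
    ⟨x, Metric.mem_closedBall_self hr.le⟩ hcont.continuousOn
  refine ⟨y₀, hy₀, ?_⟩
  rw [div_le_iff₀ (mul_pos hr hL0)]
  have h := abs_circulation_le_of_fderiv_le hv.continuous (fun y _ => hv.differentiable one_ne_zero y)
    (fun y hy => isMaxOn_iff.1 hmax y hy) hγ hloop hball hL
  calc circulation v γ ≤ |circulation v γ| := le_abs_self _
    _ ≤ ‖fderiv ℝ v y₀‖ * r * L := h
    _ = ‖fderiv ℝ v y₀‖ * (r * L) := mul_assoc _ _ _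

end LoopKinematics

/-! ## §2 One registered loop of level `j`: the speed and strain it forces -/

namespace TowerRates

variable (R : TowerRates)

/-- `Y_j = N_j^{β-2} · N_j` (velocity scale = circulation scale × frequency). [folklore] -/
theorem Y_eq_rpow_mul_N (j : ℕ) : R.Y j = R.N j ^ (R.β - 2) * R.N j := by
  have hN := R.N_pos j
  show R.N j ^ (R.β - 1) = R.N j ^ (R.β - 2) * R.N j
  rw [show R.β - 1 = (R.β - 2) + 1 by ring, Real.rpow_add hN, Real.rpow_one]

/-- `A_j = N_j^{β-2} · N_j²` (strain scale = circulation scale × frequency²). [folklore] -/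
theorem A_eq_rpow_mul_N_sq (j : ℕ) : R.A j = R.N j ^ (R.β - 2) * R.N j ^ 2 := by
  have hN := R.N_pos j
  show R.N j ^ R.β = R.N j ^ (R.β - 2) * R.N j ^ 2
  rw [show R.β = (R.β - 2) + 2 by ring, Real.rpow_add hN]
  congr 1
  · ring_nf
  · exact_mod_cast Real.rpow_natCast (R.N j) 2

end TowerRates

section OneLoop

variable {R : TowerRates} {S : Schedule R}

/-- **Speed floor from one registered core loop**: a loop of the level-`j` class (centre `x` in the tower's
ball, image in `B̄(x, 1/N_j)`, speed `≤ 8π/N_j`) around which a continuous field `w` has circulation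
`≥ c₁ N_j^{β-2}` carries a point, within `radius + 1/N_j` of the origin, of speed `≥ c₁ Y_j / (8π)`.
[cite: Palasek2026ElementaryModel, §3.1] -/
theorem core_loop_speed_floor {w : EuclideanSpace ℝ (Fin 3) → EuclideanSpace ℝ (Fin 3)}
    (hw : Continuous w) {j : ℕ} {x : EuclideanSpace ℝ (Fin 3)} {γ : ℝ → EuclideanSpace ℝ (Fin 3)}
    (hx : ‖x‖ ≤ S.radius) (hγ : ContDiff ℝ 1 γ)
    (hball : ∀ s ∈ Icc (0 : ℝ) 1, γ s ∈ Metric.closedBall x (1 / R.N j))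
    (hspeed : ∀ s ∈ Icc (0 : ℝ) 1, ‖deriv γ s‖ ≤ 8 * π / R.N j)
    (hcirc : S.c₁ * R.N j ^ (R.β - 2) ≤ circulation w γ) :
    ∃ y, ‖y‖ ≤ S.radius + 1 / R.N j ∧ S.c₁ * R.Y j / (8 * π) ≤ ‖w y‖ := by
  have hN := R.N_pos j
  have hL0 : 0 < 8 * π / R.N j := by positivity
  obtain ⟨s, hs, hge⟩ :=
    exists_norm_ge_circulation_div hL0 (hw.comp hγ.continuous) hspeed
  refine ⟨γ s, ?_, ?_⟩
  · have h1 : ‖γ s - x‖ ≤ 1 / R.N j := by rw [← dist_eq_norm]; exact Metric.mem_closedBall.1 (hball s hs)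
    calc ‖γ s‖ = ‖(γ s - x) + x‖ := by rw [sub_add_cancel]
      _ ≤ ‖γ s - x‖ + ‖x‖ := norm_add_le _ _
      _ ≤ 1 / R.N j + S.radius := add_le_add h1 hx
      _ = S.radius + 1 / R.N j := add_comm _ _
  · calc S.c₁ * R.Y j / (8 * π) = S.c₁ * R.N j ^ (R.β - 2) / (8 * π / R.N j) := by
          rw [R.Y_eq_rpow_mul_N j]
          field_simp
      _ ≤ circulation w γ / (8 * π / R.N j) := by gcongr
      _ ≤ ‖w (γ s)‖ := hge

/-- **Strain floor from one registered core loop** (no Stokes theorem): a closed `C¹` loop of the level-`j`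
class around which a `C¹` field `w` has circulation `≥ c₁ N_j^{β-2}` forces `‖Dw‖ ≥ c₁ A_j / (8π)` at a point
of the core ball `B̄(x, 1/N_j)`, within `radius + 1/N_j` of the origin. [cite: Palasek2026ElementaryModel, §3.1] -/
theorem core_loop_strain_floor {w : EuclideanSpace ℝ (Fin 3) → EuclideanSpace ℝ (Fin 3)}
    (hw : ContDiff ℝ 1 w) {j : ℕ} {x : EuclideanSpace ℝ (Fin 3)} {γ : ℝ → EuclideanSpace ℝ (Fin 3)}
    (hx : ‖x‖ ≤ S.radius) (hγ : ContDiff ℝ 1 γ) (hloop : γ 0 = γ 1)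
    (hball : ∀ s ∈ Icc (0 : ℝ) 1, γ s ∈ Metric.closedBall x (1 / R.N j))
    (hspeed : ∀ s ∈ Icc (0 : ℝ) 1, ‖deriv γ s‖ ≤ 8 * π / R.N j)
    (hcirc : S.c₁ * R.N j ^ (R.β - 2) ≤ circulation w γ) :
    ∃ y, ‖y‖ ≤ S.radius + 1 / R.N j ∧ S.c₁ * R.A j / (8 * π) ≤ ‖fderiv ℝ w y‖ := by
  have hN := R.N_pos j
  have hr : 0 < 1 / R.N j := by positivity
  have hL0 : 0 < 8 * π / R.N j := by positivity
  obtain ⟨y, hy, hge⟩ :=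
    exists_norm_fderiv_ge_circulation_div hr hL0 hw hγ hloop hball hspeed
  refine ⟨y, ?_, ?_⟩
  · have h1 : ‖y - x‖ ≤ 1 / R.N j := by rw [← dist_eq_norm]; exact Metric.mem_closedBall.1 hy
    calc ‖y‖ = ‖(y - x) + x‖ := by rw [sub_add_cancel]
      _ ≤ ‖y - x‖ + ‖x‖ := norm_add_le _ _
      _ ≤ 1 / R.N j + S.radius := add_le_add h1 hx
      _ = S.radius + 1 / R.N j := add_comm _ _
  · calc S.c₁ * R.A j / (8 * π)
          = S.c₁ * R.N j ^ (R.β - 2) / (1 / R.N j * (8 * π / R.N j)) := by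
          rw [R.A_eq_rpow_mul_N_sq j]
          field_simp
      _ ≤ circulation w γ / (1 / R.N j * (8 * π / R.N j)) := by gcongr
      _ ≤ ‖fderiv ℝ w y‖ := hge

/-- **The ceiling caps every registered loop's circulation.** If `‖w‖ ≤ c₂ Y_j` everywhere, every curve
of the level-`j` class (speed `≤ 8π/N_j` on `[0, 1]`) has `|∮ w · dℓ| ≤ 8π c₂ N_j^{β-2}`.
[cite: Palasek2026ElementaryModel, §3.1] -/
theorem abs_circulation_le_of_ceiling {w : EuclideanSpace ℝ (Fin 3) → EuclideanSpace ℝ (Fin 3)}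
    {j : ℕ} (hceil : ∀ y, ‖w y‖ ≤ S.c₂ * R.Y j) {γ : ℝ → EuclideanSpace ℝ (Fin 3)}
    (hspeed : ∀ s ∈ Icc (0 : ℝ) 1, ‖deriv γ s‖ ≤ 8 * π / R.N j) :
    |circulation w γ| ≤ 8 * π * S.c₂ * R.N j ^ (R.β - 2) := by
  have hN := R.N_pos j
  have h := abs_circulation_le_of_speed_le (fun s _ => hceil (γ s)) hspeed
  calc |circulation w γ| ≤ S.c₂ * R.Y j * (8 * π / R.N j) := h
    _ = 8 * π * S.c₂ * R.N j ^ (R.β - 2) := by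
        rw [R.Y_eq_rpow_mul_N j]
        field_simp

end OneLoop

/-! ## §3 Register corollaries: the core ledger, stages, the circulation band -/

section Register

variable {R : TowerRates} {S : Schedule R} {k : ℕ}
  {u : ℝ → EuclideanSpace ℝ (Fin 3) → EuclideanSpace ℝ (Fin 3)}

/-- **The core ledger forces speed `≥ c₁ Y_j / (8π)` at every recorded level** (at a point of the recorded
loop, within `radius + 1/N_j`), for readout slices that are continuous. [cite: Palasek2026ElementaryModel, §3.1] -/
theorem CoreLedger.exists_speed_ge (h : CoreLedger R S k u) {j : ℕ} (hj : j ≤ k)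
    (hu : Continuous (u (S.τ j))) :
    ∃ y, ‖y‖ ≤ S.radius + 1 / R.N j ∧ S.c₁ * R.Y j / (8 * π) ≤ ‖u (S.τ j) y‖ := by
  obtain ⟨x, γ, hx, hγ, -, hball, hspeed, hcirc⟩ := h j hj
  exact core_loop_speed_floor hu hx hγ hball hspeed hcirc

/-- **The core ledger forces strain `≥ c₁ A_j / (8π)` at every recorded level** (at a point of the core
ball, within `radius + 1/N_j`), for readout slices that are `C¹`. [cite: Palasek2026ElementaryModel, §3.1] -/
theorem CoreLedger.exists_fderiv_ge (h : CoreLedger R S k u) {j : ℕ} (hj : j ≤ k)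
    (hu : ContDiff ℝ 1 (u (S.τ j))) :
    ∃ y, ‖y‖ ≤ S.radius + 1 / R.N j ∧ S.c₁ * R.A j / (8 * π) ≤ ‖fderiv ℝ (u (S.τ j)) y‖ := by
  obtain ⟨x, γ, hx, hγ, hloop, hball, hspeed, hcirc⟩ := h j hj
  exact core_loop_strain_floor hu hx hγ hloop hball hspeed hcirc

namespace Stage

variable {ν : ℝ} {m : Margins R}

/-- The readout slices of a stage are `C¹` (they are `C^∞`). [folklore] -/
theorem contDiff_one_readout (s : Stage ν R S m k) {j : ℕ} (hj : j ≤ k) :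
    ContDiff ℝ 1 (s.u (S.τ j)) :=
  (s.classical.contDiff_velocity (t := S.τ j) ⟨(S.τ_pos j).le, S.τ_mono hj⟩).of_le (by norm_cast)

/-- **A stage's ceiling caps every registered loop**: at each readout `τ j`, `j ≤ k`, every curve of the
level-`j` class has `|∮ u(τ j) · dℓ| ≤ 8π c₂ N_j^{β-2}` (any `ν`, rates, margin). [cite: Palasek2026ElementaryModel, §3.1] -/
theorem abs_circulation_loop_le (s : Stage ν R S m k) {j : ℕ} (hj : j ≤ k)
    {γ : ℝ → EuclideanSpace ℝ (Fin 3)} (hspeed : ∀ σ ∈ Icc (0 : ℝ) 1, ‖deriv γ σ‖ ≤ 8 * π / R.N j) :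
    |circulation (s.u (S.τ j)) γ| ≤ 8 * π * S.c₂ * R.N j ^ (R.β - 2) :=
  abs_circulation_le_of_ceiling
    (fun y => s.ceiling j hj (S.τ j) ⟨(S.τ_pos j).le, le_rfl⟩ y) hspeed

/-- The registered core of a v2.3′ stage forces speed `≥ c₁ Y_j / (8π)` on its loop (every `j ≤ k`; point
within `radius + 1/N_j`). [cite: Palasek2026ElementaryModel, §3.1] -/
theorem routeG_core_speed_ge (s : Stage ν R S (Margins.routeG R) k) {j : ℕ} (hj : j ≤ k) :
    ∃ y, ‖y‖ ≤ S.radius + 1 / R.N j ∧ S.c₁ * R.Y j / (8 * π) ≤ ‖s.u (S.τ j) y‖ :=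
  s.routeG_coreLedger.exists_speed_ge hj (s.contDiff_one_readout hj).continuous

/-- The registered core of a v2.3′ stage forces strain `≥ c₁ A_j / (8π)` in its core ball (every `j ≤ k`;
point within `radius + 1/N_j`). [cite: Palasek2026ElementaryModel, §3.1] -/
theorem routeG_core_strain_ge (s : Stage ν R S (Margins.routeG R) k) {j : ℕ} (hj : j ≤ k) :
    ∃ y, ‖y‖ ≤ S.radius + 1 / R.N j ∧ S.c₁ * R.A j / (8 * π) ≤ ‖fderiv ℝ (s.u (S.τ j)) y‖ :=
  s.routeG_coreLedger.exists_fderiv_ge hj (s.contDiff_one_readout hj)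

/-- **The circulation band of the registered core**: at every level `j ≤ k` of a v2.3′ stage the recorded
core loop has circulation in `[c₁, 8π c₂] · N_j^{β-2}` (ledger floor, ceiling cap; any `ν`, rates). [cite: Palasek2026ElementaryModel, §3.1] -/
theorem routeG_core_circulation_band (s : Stage ν R S (Margins.routeG R) k) {j : ℕ} (hj : j ≤ k) :
    ∃ (x : EuclideanSpace ℝ (Fin 3)) (γ : ℝ → EuclideanSpace ℝ (Fin 3)),
      ‖x‖ ≤ S.radius ∧ ContDiff ℝ 1 γ ∧ γ 0 = γ 1 ∧
      (∀ σ ∈ Icc (0 : ℝ) 1, γ σ ∈ Metric.closedBall x (1 / R.N j)) ∧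
      (∀ σ ∈ Icc (0 : ℝ) 1, ‖deriv γ σ‖ ≤ 8 * π / R.N j) ∧
      S.c₁ * R.N j ^ (R.β - 2) ≤ circulation (s.u (S.τ j)) γ ∧
      circulation (s.u (S.τ j)) γ ≤ 8 * π * S.c₂ * R.N j ^ (R.β - 2) := by
  obtain ⟨x, γ, hx, hγ, hloop, hball, hspeed, hcirc⟩ := s.routeG_coreLedger j hj
  exact ⟨x, γ, hx, hγ, hloop, hball, hspeed, hcirc,
    (le_abs_self _).trans (s.abs_circulation_loop_le hj hspeed)⟩

/-- **The band by value (rigid, wide rates)**: `N_j^{3/10} ≤ Γ ≤ (40π/3) N_j^{3/10}` — the circulation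
Reynolds number of the registered core at unit viscosity, inside the fixed factor `40π/3`. [cite: Palasek2026ElementaryModel, §3.1] -/
theorem routeG_core_circulation_band_rigid {S : Schedule TowerRates.wide}
    (s : Stage ν TowerRates.wide S (Margins.routeG TowerRates.wide) k) {j : ℕ} (hj : j ≤ k) :
    ∃ (x : EuclideanSpace ℝ (Fin 3)) (γ : ℝ → EuclideanSpace ℝ (Fin 3)),
      ‖x‖ ≤ S.radius ∧ ContDiff ℝ 1 γ ∧ γ 0 = γ 1 ∧
      (∀ σ ∈ Icc (0 : ℝ) 1, γ σ ∈ Metric.closedBall x (1 / TowerRates.wide.N j)) ∧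
      (∀ σ ∈ Icc (0 : ℝ) 1, ‖deriv γ σ‖ ≤ 8 * π / TowerRates.wide.N j) ∧
      TowerRates.wide.N j ^ (3 / 10 : ℝ) ≤ circulation (s.u (S.τ j)) γ ∧
      circulation (s.u (S.τ j)) γ ≤ 40 * π / 3 * TowerRates.wide.N j ^ (3 / 10 : ℝ) := by
  obtain ⟨x, γ, hx, hγ, hloop, hball, hspeed, hlo, hhi⟩ := s.routeG_core_circulation_band hj
  have hrig : S.Rigid := s.routeG_rigid
  have hβ : TowerRates.wide.β - 2 = 3 / 10 := by
    show (23 : ℝ) / 10 - 2 = 3 / 10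
    norm_num
  rw [hrig.c₁_eq, hβ, one_mul] at hlo
  rw [hrig.c₂_eq, hβ] at hhi
  refine ⟨x, γ, hx, hγ, hloop, hball, hspeed, hlo, ?_⟩
  calc circulation (s.u (S.τ j)) γ ≤ 8 * π * (5 / 3) * TowerRates.wide.N j ^ (3 / 10 : ℝ) := hhi
    _ = 40 * π / 3 * TowerRates.wide.N j ^ (3 / 10 : ℝ) := by ring

end Stage

end Register

/-! ## §4 The readout of a continuation: the core conjunct of `ReadoutFloors` carries the other two -/

section Readout

variable {S : Schedule TowerRates.wide} {k : ℕ}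
  {u : ℝ → EuclideanSpace ℝ (Fin 3) → EuclideanSpace ℝ (Fin 3)} {p : ℝ → EuclideanSpace ℝ (Fin 3) → ℝ}

/-- **What the core conjunct of `ReadoutFloors` costs a continuation**: for a classical continuation to
`τ (k+1)` (any force / viscosity), the core clause of level `k + 1` at `τ (k+1)` yields a point within
`radius + 1/N_{k+1}` of speed `≥ c₁ Y_{k+1} / (8π)` and one of strain `≥ c₁ A_{k+1} / (8π)` — the velocity
and strain conjuncts up to `8π` and the ball slack `1/N_{k+1}`. [cite: Palasek2026ElementaryModel, §3.1] -/
theorem readout_core_floors {f : ℝ → EuclideanSpace ℝ (Fin 3) → EuclideanSpace ℝ (Fin 3)} {ν : ℝ}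
    (hcl : IsClassicalNSSolutionOn (Icc 0 (S.τ (k + 1))) ν f u p)
    (hcore : ∃ (x : EuclideanSpace ℝ (Fin 3)) (γ : ℝ → EuclideanSpace ℝ (Fin 3)),
      ‖x‖ ≤ S.radius ∧ ContDiff ℝ 1 γ ∧ γ 0 = γ 1 ∧
      (∀ σ ∈ Icc (0 : ℝ) 1, γ σ ∈ Metric.closedBall x (1 / TowerRates.wide.N (k + 1))) ∧
      (∀ σ ∈ Icc (0 : ℝ) 1, ‖deriv γ σ‖ ≤ 8 * π / TowerRates.wide.N (k + 1)) ∧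
      S.c₁ * TowerRates.wide.N (k + 1) ^ (TowerRates.wide.β - 2) ≤ circulation (u (S.τ (k + 1))) γ) :
    (∃ y, ‖y‖ ≤ S.radius + 1 / TowerRates.wide.N (k + 1) ∧
      S.c₁ * TowerRates.wide.Y (k + 1) / (8 * π) ≤ ‖u (S.τ (k + 1)) y‖) ∧
    (∃ y, ‖y‖ ≤ S.radius + 1 / TowerRates.wide.N (k + 1) ∧
      S.c₁ * TowerRates.wide.A (k + 1) / (8 * π) ≤ ‖fderiv ℝ (u (S.τ (k + 1))) y‖) := by
  obtain ⟨x, γ, hx, hγ, hloop, hball, hspeed, hcirc⟩ := hcore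
  have hC1 : ContDiff ℝ 1 (u (S.τ (k + 1))) :=
    (hcl.contDiff_velocity (t := S.τ (k + 1)) ⟨(S.τ_pos _).le, le_rfl⟩).of_le (by norm_cast)
  exact ⟨core_loop_speed_floor hC1.continuous hx hγ hball hspeed hcirc,
    core_loop_strain_floor hC1 hx hγ hloop hball hspeed hcirc⟩

/-- **The next ceiling caps the new core's circulation**: inside the ceiling `c₂ Y_{k+1}`, every curve of
the level-`(k+1)` class read at `τ (k+1)` has `|∮ u · dℓ| ≤ 8π c₂ N_{k+1}^{β-2}` (so the core conjunct of
`ReadoutFloors` asks a circulation in `[c₁, 8π c₂] · N_{k+1}^{β-2}`). [cite: Palasek2026ElementaryModel, §3.1] -/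
theorem readout_core_circulation_le
    (hceil : ∀ t ∈ Icc 0 (S.τ (k + 1)), ∀ x, ‖u t x‖ ≤ S.c₂ * TowerRates.wide.Y (k + 1))
    {γ : ℝ → EuclideanSpace ℝ (Fin 3)}
    (hspeed : ∀ σ ∈ Icc (0 : ℝ) 1, ‖deriv γ σ‖ ≤ 8 * π / TowerRates.wide.N (k + 1)) :
    |circulation (u (S.τ (k + 1))) γ| ≤
      8 * π * S.c₂ * TowerRates.wide.N (k + 1) ^ (TowerRates.wide.β - 2) :=
  abs_circulation_le_of_ceiling (hceil (S.τ (k + 1)) ⟨(S.τ_pos _).le, le_rfl⟩) hspeed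

/-- **The lower half is its core conjunct up to `8π` (kernel form)**: `ReadoutFloors` implies — through
`readout_core_floors`, by its CORE conjunct alone — that every finite-energy classical continuation of a
v2.3′ stage at a level `k ≥ 2` inside the next ceiling shows, at `τ (k+1)` and within `radius + 1/N_{k+1}`,
speed `≥ c₁ Y_{k+1} / (8π)` and strain `≥ c₁ A_{k+1} / (8π)` (the registered conjuncts ask `c₁` inside the
ball; the gap is the factor `8π` and the slack `1/N_{k+1} ≤ 256^{-121/100}`). [cite: Palasek2026ElementaryModel, §3.1] -/
theorem ReadoutFloors.weak_floors_of_core (h : ReadoutFloors) :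
    ∀ S : Schedule TowerRates.wide, S.Pins 8 (6 / 5) → S.Rigid → S.Quiet → ∀ k : ℕ, 2 ≤ k →
    ∀ s : Stage 1 TowerRates.wide S (Margins.routeG TowerRates.wide) k,
    ∀ (u : ℝ → EuclideanSpace ℝ (Fin 3) → EuclideanSpace ℝ (Fin 3))
      (p : ℝ → EuclideanSpace ℝ (Fin 3) → ℝ),
      IsClassicalNSSolutionOn (Icc 0 (S.τ (k + 1))) 1 S.f u p →
      (∀ t ∈ Icc 0 (S.τ k), u t = s.u t ∧ p t = s.p t) →
      (∃ C : ℝ≥0∞, C < ⊤ ∧ ∀ t ∈ Icc 0 (S.τ (k + 1)), ∫⁻ x, ‖u t x‖ₑ ^ 2 ≤ C) →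
      (∀ t ∈ Icc 0 (S.τ (k + 1)), ∀ x, ‖u t x‖ ≤ S.c₂ * TowerRates.wide.Y (k + 1)) →
      (∃ y, ‖y‖ ≤ S.radius + 1 / TowerRates.wide.N (k + 1) ∧
        S.c₁ * TowerRates.wide.Y (k + 1) / (8 * π) ≤ ‖u (S.τ (k + 1)) y‖) ∧
      (∃ y, ‖y‖ ≤ S.radius + 1 / TowerRates.wide.N (k + 1) ∧
        S.c₁ * TowerRates.wide.A (k + 1) / (8 * π) ≤ ‖fderiv ℝ (u (S.τ (k + 1))) y‖) := by
  intro S hP hR hQ k hk s u p hcl hagree hE hceil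
  obtain ⟨-, -, hcore⟩ := h S hP hR hQ k hk s u p hcl hagree hE hceil
  exact readout_core_floors hcl hcore

end Readout

end Summit.NavierStokesRegularity.FluidComputer.PalasekTowerClayBridge

end
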